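import Summits.QuantumFields.QCD.Theorems.EulerDescentRetypedContinuumComplementHeavyCalibrationOrderedBinomial
import Literature.MathematicalPhysics.QuantumLattice.SchwartzTensor
import Literature.MathematicalPhysics.AQFT.OSAxiomsSchwinger
import HarnessLib

/-!
# Sub-tensors of off-diagonal tensor test functions are off-diagonal
(helper of stub `stub_heavyCalibration`, line `vitali-mass-descent`, crux
`Summit.QuantumFields.QCD.Theses.EulerDescent.RetypedContinuumComplement`, item stmt-QuantumFields-16903)

The scheme-transfer identity (`…HeavyCalibrationTransfer`) writes a calibrated `n`-point function on
the tuple `f = (f₀, …, f_{n−1})` through the reference functions of ALL sub-strings `f ∘ e_B`,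
`B ⊆ Fin n`; the heavy body controls reference functions only on tensors of `⁰𝒮` (`IsOffDiagonal`).
This file supplies the missing test-function fact: if `F = f₀ ⊗ ⋯ ⊗ f_{n−1}` lies in `⁰𝒮ₙ` (vanishes
with all derivatives at coincident points) and the factors OFF the subset `B` are not identically zero,
then every tensor witness `G` of the sub-tuple `f ∘ e_B` lies in `⁰𝒮_{|B|}` (`isOffDiagonal_subTensor`).
Proof without any Leibniz rule: freeze the coordinates off `B` at points `aᵢ` with `fᵢ(aᵢ) ≠ 0`; the
affine map `x ↦ (x on B, a off B)` pulls `F` back to the non-zero constant `∏_{i ∉ B} fᵢ(aᵢ)` times `G`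
and maps coincident points to coincident points, and iterated derivatives of a pull-back along an
affine map are the pulled-back iterated derivatives (`ContinuousLinearMap.iteratedFDeriv_comp_right`,
`iteratedFDeriv_comp_add_right`) — `isOffDiagonal_of_affine_pullback`.  Def-free theorem file. [folklore]
-/

noncomputable section

namespace Summit.QuantumFields.QCD.Cruxes.RetypedContinuumComplement.VitaliMassDescent

open scoped BigOperators SchwartzMap
open Literature.MathematicalPhysics.AQFT Literature.MathematicalPhysics.QuantumLattice

variable {E : Type*} [NormedAddCommGroup E] [NormedSpace ℝ E]

/-- **`⁰𝒮` is stable under affine pull-backs that preserve coincidences, up to non-zero constants.**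
If `F ∈ ⁰𝒮ₙ`, `L : E^m → E^n` is continuous linear, `a ∈ E^n`, `x ↦ L x + a` maps the coincidence
locus of `E^m` into that of `E^n`, and `c · G = F ∘ (L · + a)` pointwise with `c ≠ 0`, then `G ∈ ⁰𝒮ₘ`.
[folklore] -/
theorem isOffDiagonal_of_affine_pullback {n m : ℕ} {F : 𝓢((Fin n → E), ℂ)} (hF : IsOffDiagonal F)
    {G : 𝓢((Fin m → E), ℂ)} (L : (Fin m → E) →L[ℝ] (Fin n → E)) (a : Fin n → E) {c : ℂ} (hc : c ≠ 0)
    (hL : ∀ x ∈ coincidenceLocus m E, L x + a ∈ coincidenceLocus n E)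
    (hG : ∀ x, c * G x = F (L x + a)) : IsOffDiagonal G := by
  intro x hx k
  have hfun : (c • (G : (Fin m → E) → ℂ)) = (fun y => (F : (Fin n → E) → ℂ) (y + a)) ∘ L := by
    funext y
    simp only [Pi.smul_apply, smul_eq_mul, Function.comp_apply]
    exact hG y
  have hsm : ContDiff ℝ k fun y : Fin n → E => (F : (Fin n → E) → ℂ) (y + a) :=
    (F.smooth k).comp (contDiff_id.add contDiff_const)
  have h1 : iteratedFDeriv ℝ k (c • (G : (Fin m → E) → ℂ)) x = c • iteratedFDeriv ℝ k (G : (Fin m → E) → ℂ) x :=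
    iteratedFDeriv_const_smul_apply (G.smooth k).contDiffAt
  have h2 := L.iteratedFDeriv_comp_right hsm x (i := k) le_rfl
  have h3 : iteratedFDeriv ℝ k (fun y : Fin n → E => (F : (Fin n → E) → ℂ) (y + a)) (L x) = 0 := by
    rw [iteratedFDeriv_comp_add_right k a (L x)]
    exact hF _ (hL x hx) k
  have h0 : c • iteratedFDeriv ℝ k (G : (Fin m → E) → ℂ) x = 0 := by
    rw [← h1, hfun, h2, h3]
    ext v
    simp
  exact (smul_eq_zero.1 h0).resolve_left hc

/-- **Sub-tensors of off-diagonal tensors are off-diagonal.**  Let `F = f₀ ⊗ ⋯ ⊗ f_{n−1} ∈ ⁰𝒮ₙ`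
(`IsTensorOf F f`, `IsOffDiagonal F`) and let `B ⊆ Fin n` be such that every factor `fᵢ` with `i ∉ B`
is not identically zero.  Then every tensor witness `G` of the sub-tuple `f ∘ e_B`
(`e_B = B.orderEmbOfFin rfl`) lies in `⁰𝒮_{|B|}`. [folklore] -/
theorem isOffDiagonal_subTensor {n : ℕ} {f : Fin n → 𝓢(E, ℂ)} {F : 𝓢((Fin n → E), ℂ)}
    (hF : IsTensorOf F f) (hO : IsOffDiagonal F) (B : Finset (Fin n))
    (hne : ∀ i, i ∉ B → ∃ y, f i y ≠ 0) {G : 𝓢((Fin B.card → E), ℂ)}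
    (hG : IsTensorOf G fun j => f (B.orderEmbOfFin rfl j)) : IsOffDiagonal G := by
  classical
  -- frozen coordinates off `B`
  have hch : ∀ i, ∃ y : E, i ∉ B → f i y ≠ 0 := fun i => by
    by_cases hi : i ∈ B
    · exact ⟨0, fun h => (h hi).elim⟩
    · obtain ⟨y, hy⟩ := hne i hi
      exact ⟨y, fun _ => hy⟩
  choose a ha using hch
  -- the affine embedding `x ↦ (x on B, a off B)`
  set idx : (i : Fin n) → i ∈ B → Fin B.card := fun i h => (B.orderIsoOfFin rfl).symm ⟨i, h⟩ with hidx
  set L : (Fin B.card → E) →L[ℝ] (Fin n → E) :=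
    ContinuousLinearMap.pi fun i => if h : i ∈ B then ContinuousLinearMap.proj (R := ℝ) (idx i h) else 0
    with hLdef
  set a' : Fin n → E := fun i => if i ∈ B then 0 else a i with ha'
  have hLB : ∀ (x : Fin B.card → E) (j : Fin B.card), (L x + a') (B.orderEmbOfFin rfl j) = x j := by
    intro x j
    have hmem : B.orderEmbOfFin rfl j ∈ B := Finset.orderEmbOfFin_mem B rfl j
    have hj : idx (B.orderEmbOfFin rfl j) hmem = j := by
      have : (⟨B.orderEmbOfFin rfl j, hmem⟩ : {i // i ∈ B}) = B.orderIsoOfFin rfl j :=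
        Subtype.ext (Finset.coe_orderIsoOfFin_apply B rfl j).symm
      simp only [hidx, this, OrderIso.symm_apply_apply]
    simp only [hLdef, ha', Pi.add_apply, ContinuousLinearMap.pi_apply, dif_pos hmem, if_pos hmem,
      ContinuousLinearMap.proj_apply, hj, add_zero]
  have hLc : ∀ (x : Fin B.card → E) (i : Fin n), i ∉ B → (L x + a') i = a i := by
    intro x i hi
    simp only [hLdef, ha', Pi.add_apply, ContinuousLinearMap.pi_apply, dif_neg hi, if_neg hi,
      zero_apply, zero_add]
  -- the non-zero constant
  have hc : (∏ i ∈ Bᶜ, f i (a i)) ≠ 0 :=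
    Finset.prod_ne_zero_iff.2 fun i hi => ha i (Finset.mem_compl.1 hi)
  refine isOffDiagonal_of_affine_pullback hO L a' hc (fun x hx => ?_) (fun x => ?_)
  · obtain ⟨j, j', hjj', hxx⟩ := hx
    refine ⟨B.orderEmbOfFin rfl j, B.orderEmbOfFin rfl j', fun h => hjj' ((B.orderEmbOfFin rfl).injective h), ?_⟩
    rw [hLB, hLB, hxx]
  · rw [hF, ← Finset.prod_mul_prod_compl B, hG x, mul_comm]
    congr 1
    · rw [← prod_orderEmbOfFin B fun i => f i ((L x + a') i)]
      exact Finset.prod_congr rfl fun j _ => by rw [hLB]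
    · exact Finset.prod_congr rfl fun i hi => by rw [hLc x i (Finset.mem_compl.1 hi)]

/-- **Real form**: for a tuple of REAL one-point test functions `f` with off-diagonal tensor
`F = ⊗ᵢ ofRealTest (fᵢ)` and a subset `B` off which no `fᵢ` is the zero function, every tensor witness
of the real sub-tuple `f ∘ e_B` is off-diagonal. [folklore] -/
theorem isOffDiagonal_subTensor_ofRealTest {n : ℕ} {f : Fin n → 𝓢(E, ℝ)} {F : 𝓢((Fin n → E), ℂ)}
    (hF : IsTensorOf F fun i => ofRealTest (f i)) (hO : IsOffDiagonal F) (B : Finset (Fin n))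
    (hne : ∀ i, i ∉ B → f i ≠ 0) {G : 𝓢((Fin B.card → E), ℂ)}
    (hG : IsTensorOf G fun j => ofRealTest (f (B.orderEmbOfFin rfl j))) : IsOffDiagonal G := by
  refine isOffDiagonal_subTensor (f := fun i => ofRealTest (f i)) hF hO B (fun i hi => ?_) hG
  by_contra h
  refine hne i hi (SchwartzMap.ext fun y => ?_)
  have hy : ¬ (ofRealTest (f i) y ≠ 0) := fun h' => h ⟨y, h'⟩
  rw [not_not, ofRealTest_apply, Complex.ofReal_eq_zero] at hy
  exact hy

end Summit.QuantumFields.QCD.Cruxes.RetypedContinuumComplement.VitaliMassDescent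

end
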